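/-
Copyright (c) 2026. All rights reserved.
Released under Apache 2.0 license as described in the file LICENSE.
Authors: abc-iut cell, statement-typer seat abc-iut-L4-t3 (wave 1; gen 9), owner of the §5 interface
`LogFrobeniusSetting`, over abc-iut-w6-d025's arc chart and abc-iut-w4-d095's `TB⊞` category.
-/
import Literature.AnabelianGeometry.AbsoluteAnabelian.LogFrobeniusMonoTelecoreCoherence
import Literature.AnabelianGeometry.AbsoluteAnabelian.AutHolFieldFunctorMonoAnalyticization
import HarnessLib

/-!
# [AbsTopIII] Def 5.4 (v)/(vii), Cor 5.10 (iv)(c): NO carrier of the frozen §5 interface has print's archimedean `TB⊞`-shapes — `MonoTelecoreCoherence` is EMPTY at every print-shaped `ψ`-side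

S. Mochizuki, *Topics in absolute anabelian geometry III*, J. Math. Sci. Univ. Tokyo 22 (2015) 939–1156
[MochizukiAbsTopIII2015]; locators = pages of the author's manuscript (`paper:url-5493eb38cbb7`), read on the page (own
render): Def 5.4 (v) p. 127 l. 53–64 (the archimedean diagram `k~ →(id) k~ →(shell) k^× ↪ k`; "Observe that the entire
diagram `Γ⃗^log_arc` may be considered as a diagram in the category `TH`, whereas the diagram `Γ⃗^⋉_arc` [= without the
arrow `↪ k`] may be considered either as a diagram in the category `TH` or as a diagram in `TH⊞`"), Def 5.4 (vii) p. 128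
l. 45–55 ("For each edge `ε` of `Γ⃗^⋉_v` (respectively, `Γ⃗^log_v`) … a natural transformation
`ι⊞_{v,ε} : λ⊞_{v,ν₁} ∘ Λ_{ν₁} → λ⊞_{v,ν₂}` (respectively, `ι_{v,ε} : λ_{v,ν₁} ∘ Λ_{ν₁} → λ_{v,ν₂}`)"), Cor 5.5 (iii) p. 131
l. 22–26 ("`ι⊞_{v,ε}` (respectively, `ι_{v,ε}`) — where `v ∈ 𝕍(F_mod)`; `ε` is an edge of `Γ⃗^⋉_v` (respectively,
`Γ⃗^log_v`)" — the alternation is uniform in `v`), Prop 5.8 (iv), (v) p. 140 (`k~(G) := C~ × C~`, `k^×(G) := C^× × C~`,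
`C^× = C~/F`), Cor 5.10 (iv)(c) p. 148 (the natural isomorphism `η⊢_{v,ν}` from `γ¹_{v,ν}` to `γ⁰_{v,ν}`).

## What this file proves (PROOF-ONLY; a kernel fact about OUR frozen typing, not a claim about print)

The frozen interface `LogFrobeniusSetting` (`LogFrobeniusCompatibility.lean`, this lineage gens 0–2) types the `⊞`-valued
homotopies `ι⊞_{v,ε}` over `LogEdge (isArc v)`, and `LogEdge true := ArchEdge` — ALL three archimedean arrows, including
the space-link inclusion `k^× ↪ k` (docstring l. 90: "all edges of `Γ⃗^log_v` for `v` archimedean", the single-"respectively"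
reading of Def 5.4 (vii)).  Cor 5.5 (iii) p. 131 l. 22–26 settles the reading the other way: at EVERY place `ι⊞` lives on
`Γ⃗^⋉_v` only, and the space-link arrow carries only the `TS`/`TH`-valued `ι_{v,ε}` (typed apart, correctly, as
`LogFrobeniusSetting.TSHomotopies.iota` over `LogEdgeTS`).  The consequence INSIDE the frozen interface:

* `TBPlus.IsPlane M` / `TBPlus.IsCircle M` — the two archimedean `TB⊞`-shapes: `(s,t) ↦ c₁ s + c₂ t` injective (`k~ ≅ ℝ²`,
  print's `C~ × C~`) versus a PERIODIC first one-parameter subgroup (`k^× ⊃ S¹`, print's `C^× × C~`);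
  `TMMono.kTildeObj_isPlane`, `TMMono.kTimesObj_isCircle` (abc-iut-w6-d025's genuine `k~(G)`, `k^×(G)`).
* `TBPlus.isEmpty_hom_of_isCircle_of_isPlane` — **no morphism of `TB⊞` maps a circle-type object to a plane-type object**
  (the period goes to `c₁ (a₁ s) = 0`, so `a₁ = 0`, so the image is the line `c₂(ℝ)`, contradicting surjectivity);
  shapes are invariant under isomorphisms (`IsPlane.of_iso`, `IsCircle.of_iso`).
* ★ `LogFrobeniusSetting.false_of_tbplus_shapes` — for EVERY setting `L`, every place `v` carrying an edge INTO the
  space-link vertex and the post-log edge, every functor `R : 𝒩⊞_v ⥤ TB⊞` and every object `x`: NOT (`R(λ⊞_{mult}(Λ y))`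
  circle-type ∧ `R(λ⊞_{pre}(x))` plane-type), `y = Λ_{post-log} x` — because the interface's `ι⊞` along `k^× ↪ k`, the proviso
  `λ⊞_{space-link} = λ⊞_{post-log}` and `ι⊞` along `k~ →(id) k~` compose to a `𝒩⊞_v`-morphism `λ⊞_{mult}(Λ y) → λ⊞_{pre}(x)`.
  All-archimedean index form: `false_of_tbplus_shapes_arc`.
* ★★ `LogFrobeniusSetting.MonoTelecoreCoherence.false_of_arc_psi_shapes` — for EVERY setting over an all-archimedean index,
  every `M`, every `K : L.MonoTelecoreCoherence M` and every `TB⊞`-reading `S : 𝒩⊢⊞_v ⥤ TB⊞` under which `ψ^{An⊢⊞}_{v,pre}` is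
  plane-type and `ψ^{An⊢⊞}_{v,mult}` circle-type (print's shapes, Prop 5.8 (iv)(v)): `False` as soon as `𝒳` has an object —
  transport the shapes along `η⊢_{v,pre}`, `η⊢_{v,mult}` (`K.eta`) and apply ★ to `R := (𝒩⊞_v → 𝒩⊢⊞_v) ⋙ S`.  I.e. the typed
  `η⊢` add-on is EMPTY at every carrier whose `ψ`-side has print's archimedean shapes, WHATEVER its `𝒩⊞_v`, `λ⊞`, `𝒩⊞_v → 𝒩⊢⊞_v`.
* ★★★ `isEmpty_monoTelecoreCoherence_archGenuineMonoAnChart` — instance: at abc-iut-w6-d025's arc chart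
  `archGenuineMonoAnChart 𝔄 Vmod (fun _ => true)` (genuine `ψ = ψArc`: `k~(G)` at `pre`, `k^×(G)` at `mult`) the add-on is
  empty for every `M` (the arc analogue of abc-iut-f-101's `LogFrobeniusMonoTelecoreCoherenceEmptyAtMonoAn`); hence the arc
  factor `K₂` of abc-iut-w6-d025's `genuineTwoSidedSum_monoTelecoreCoherence_of` is never instantiable there.

DESIGN CONSEQUENCE (cell note, not print; owner's verdict on row «ARC-MTC-B», HOME/staging/L4/L4-t3/gen9/): the label
«arc `η⊢` = K-binder» on the archimedean clauses of Cor 5.10 (iv)(b)(c) is IRREMOVABLE inside the frozen interface; its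
CONTENT is in the tree (abc-iut-w5-d038 `HolTFPair.etaTilde`/`etaTimes`, the `ι–η` square `etaTilde_hom_gammaArc`, the
no-go `HolRS.RC.isEmpty_eta_natTrans`); removing the label needs a re-typing of `γ⁰_{v,ν}` (successor structure with
`LogEdge⋉ true := {e : ArchEdge // e.InLeft}` per Cor 5.5 (iii), or cross-indexed mono-analyticization edges).
Sibling kernel certificates: abc-iut-L4-t8 `HolTFPair.isEmpty_lamTimesPlus_hom_lamSimPlus` (no `ι⊞` along `k^× ↪ k` in
`𝒞^hol_{TH⊞}`), abc-iut-w6-d036 `ComplexLogShell.spaceLinkArrow_not_hom`.  Refereed pre-IUT material; MODEL/INTERFACE-LEVEL;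
nothing here bears on [IUTchIII] Cor. 3.12; no side taken; typed ≠ proved; a kernel refutation of OUR typing is not a
claim about print.
-/

set_option autoImplicit false

universe w u

open CategoryTheory

namespace Literature.AnabelianGeometry.AbsoluteAnabelian

/-! ## §1. The two archimedean `TB⊞`-shapes and the no-go for morphisms between them -/

namespace TBPlus

variable {M N : TBPlus.{w}}

/-- **plane-type** object of `TB⊞`: the two one-parameter subgroups parametrise `B` injectively, `(s,t) ↦ c₁ s + c₂ t`
injective (with `add_surjective`, `isOpenMap_add`: `B ≅ ℝ × ℝ` — print's `k~ = C~ × C~`, the additive group of a CAF with its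
two lines). [cite: MochizukiAbsTopIII2015, Prop 5.8 (iv) p. 140] -/
def IsPlane (M : TBPlus.{w}) : Prop := Function.Injective fun p : ℝ × ℝ => M.c₁ p.1 + M.c₂ p.2

/-- **circle-type** object of `TB⊞`: the first one-parameter subgroup `B′` is periodic (print's `k^× = C^× × C~`, `C^× = C~/F`:
the compact circle inside the multiplicative group of a CAF). [cite: MochizukiAbsTopIII2015, Prop 5.8 (iv) p. 140] -/
def IsCircle (M : TBPlus.{w}) : Prop := ∃ s : ℝ, s ≠ 0 ∧ M.c₁ s = 0

/-- A plane-type object is not circle-type. [cite: MochizukiAbsTopIII2015, Def 5.6 (i) p. 134] -/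
theorem IsPlane.not_isCircle (h : M.IsPlane) : ¬ M.IsCircle := by
  rintro ⟨s, hs, h0⟩
  have h1 : (fun p : ℝ × ℝ => M.c₁ p.1 + M.c₂ p.2) (s, 0) = (fun p : ℝ × ℝ => M.c₁ p.1 + M.c₂ p.2) (0, 0) := by
    simp only [map_zero, add_zero, h0]
  exact hs (congrArg Prod.fst (h h1))

/-- **No morphism of `TB⊞` from a circle-type object to a plane-type object**: the period `s ≠ 0` of `B′₁` goes to
`c₁ (a₁ s) = 0` in the plane, forcing `a₁ = 0`; then the whole line `B′₁` dies and the image of the morphism is the line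
`c₂(ℝ) ⊊ B₂` (it misses `c₁ 1`), contradicting surjectivity. [cite: MochizukiAbsTopIII2015, Def 5.6 (i) p. 134] -/
theorem isEmpty_hom_of_isCircle_of_isPlane (hM : M.IsCircle) (hN : N.IsPlane) : IsEmpty (M ⟶ N) := by
  refine ⟨fun f => ?_⟩
  obtain ⟨s, hs, h0⟩ := hM
  -- the period forces `a₁ = 0`
  have ha : f.a₁ = 0 := by
    have h1 : N.c₁ (f.a₁ * s) = 0 := by rw [← f.map_c₁, h0, map_zero]
    have h2 : (fun p : ℝ × ℝ => N.c₁ p.1 + N.c₂ p.2) (f.a₁ * s, 0) = (fun p : ℝ × ℝ => N.c₁ p.1 + N.c₂ p.2) (0, 0) := by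
      simp only [map_zero, add_zero, h1]
    have h3 : f.a₁ * s = 0 := congrArg Prod.fst (hN h2)
    rcases mul_eq_zero.mp h3 with h | h
    · exact h
    · exact absurd h hs
  -- hence the image is the line `c₂(ℝ)`, which misses `c₁ 1`
  obtain ⟨m, hm⟩ := f.surjective (N.c₁ 1)
  obtain ⟨p, rfl⟩ := M.add_surjective m
  have h4 : f.toHom (M.c₁ p.1 + M.c₂ p.2) = N.c₂ (f.a₂ * p.2) := by
    rw [map_add, f.map_c₁, f.map_c₂, ha, zero_mul, map_zero, zero_add]
  have h5 : (fun q : ℝ × ℝ => N.c₁ q.1 + N.c₂ q.2) (1, 0) = (fun q : ℝ × ℝ => N.c₁ q.1 + N.c₂ q.2) (0, f.a₂ * p.2) := by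
    simp only [map_zero, add_zero, zero_add]
    exact hm.symm.trans h4
  exact one_ne_zero (congrArg Prod.fst (hN h5))

/-- The `B′`-rescaling of an isomorphism of `TB⊞` is nonzero (`a₁(e⁻¹)·a₁(e) = 1`, abc-iut-w4-d095).
[cite: MochizukiAbsTopIII2015, Def 5.6 (i) p. 134] -/
theorem Iso.hom_a₁_ne_zero (e : M ≅ N) : e.hom.a₁ ≠ 0 := fun h => by
  have h1 := Iso.inv_a₁_mul_hom_a₁ e
  rw [h, mul_zero] at h1
  exact zero_ne_one h1

/-- The `B″`-rescaling of an isomorphism of `TB⊞` is nonzero. [cite: MochizukiAbsTopIII2015, Def 5.6 (i) p. 134] -/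
theorem Iso.hom_a₂_ne_zero (e : M ≅ N) : e.hom.a₂ ≠ 0 := fun h => by
  have h1 := Iso.inv_a₂_mul_hom_a₂ e
  rw [h, mul_zero] at h1
  exact zero_ne_one h1

/-- Circle-type is transported along isomorphisms of `TB⊞` (the period `s` goes to the period `a₁ s ≠ 0`).
[cite: MochizukiAbsTopIII2015, Def 5.6 (i) p. 134] -/
theorem IsCircle.of_iso (h : M.IsCircle) (e : M ≅ N) : N.IsCircle := by
  obtain ⟨s, hs, h0⟩ := h
  exact ⟨e.hom.a₁ * s, mul_ne_zero (Iso.hom_a₁_ne_zero e) hs, by rw [← e.hom.map_c₁, h0, map_zero]⟩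

/-- Plane-type is transported along isomorphisms of `TB⊞` (pull the injectivity back along `e⁻¹`, whose rescalings are
nonzero). [cite: MochizukiAbsTopIII2015, Def 5.6 (i) p. 134] -/
theorem IsPlane.of_iso (h : M.IsPlane) (e : M ≅ N) : N.IsPlane := by
  intro p q hpq
  have h1 : e.inv.toHom (N.c₁ p.1 + N.c₂ p.2) = e.inv.toHom (N.c₁ q.1 + N.c₂ q.2) := congrArg e.inv.toHom hpq
  rw [map_add, map_add, e.inv.map_c₁, e.inv.map_c₂, e.inv.map_c₁, e.inv.map_c₂] at h1
  have h2 : ((e.inv.a₁ * p.1, e.inv.a₂ * p.2) : ℝ × ℝ) = (e.inv.a₁ * q.1, e.inv.a₂ * q.2) := h h1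
  simp only [Prod.mk.injEq] at h2
  have ha₁ : e.inv.a₁ ≠ 0 := Iso.hom_a₁_ne_zero e.symm
  have ha₂ : e.inv.a₂ ≠ 0 := Iso.hom_a₂_ne_zero e.symm
  exact Prod.ext (mul_left_cancel₀ ha₁ h2.1) (mul_left_cancel₀ ha₂ h2.2)

end TBPlus

/-! ## §2. abc-iut-w6-d025's genuine `k~(G)`, `k^×(G)` have print's shapes -/

namespace TMMono

/-- `k~(G) = C~ × C~` is plane-type. [cite: MochizukiAbsTopIII2015, Prop 5.8 (iv) p. 140] -/
theorem kTildeObj_isPlane : kTildeObj.{w}.IsPlane := by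
  intro p q hpq
  have h := ULift.up_inj.1 hpq
  change (p.1, (0 : ℝ)) + (0, p.2) = (q.1, (0 : ℝ)) + (0, q.2) at h
  simp only [Prod.mk_add_mk, add_zero, zero_add] at h
  exact Prod.ext (congrArg Prod.fst h) (congrArg Prod.snd h)

/-- `k^×(G) = C^× × C~` is circle-type: `B′` is the covering `C~ ↠ C^× = C~/2π`, of period `2π`.
[cite: MochizukiAbsTopIII2015, Prop 5.8 (iv) p. 140] -/
theorem kTimesObj_isCircle : kTimesObj.{w}.IsCircle := by
  refine ⟨2 * Real.pi, Real.two_pi_pos.ne', ?_⟩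
  change ULift.up ((((2 * Real.pi : ℝ)) : AddCircle (2 * Real.pi)), (0 : ℝ)) = ULift.up 0
  rw [AddCircle.coe_period]
  rfl

end TMMono

/-! ## §3. The cycle inside the frozen interface -/

namespace LogFrobeniusSetting

variable {Vmod : Type u} {isArc : Vmod → Bool} (L : LogFrobeniusSetting Vmod isArc)

/-- ★ **No `TB⊞`-reading of `𝒩⊞_v` gives `λ⊞_{v,mult}` circle-type and `λ⊞_{v,pre}` plane-type**, for ANY setting of the frozen
interface and ANY place `v` at which the interface supplies an edge `ε_incl` INTO the space-link vertex (archimedean: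
`k^× ↪ k`; at a nonarchimedean place `LogEdge` has no such edge and the statement is vacuous) and the post-log edge `ε_id`:
the interface's `ι⊞_{v,ε_incl}` at `y := Λ_{post-log} x`, the proviso `λ⊞_{space-link} = λ⊞_{post-log}` and `ι⊞_{v,ε_id}` at `x`
compose to a morphism `λ⊞_{mult}(Λ_{mult} y) → λ⊞_{pre}(x)` of `𝒩⊞_v`, whose image under `R` would be a `TB⊞`-morphism from a
circle-type to a plane-type object. [cite: MochizukiAbsTopIII2015, Def 5.4 (vii) p. 128] -/
theorem false_of_tbplus_shapes (v : Vmod) {νpre νmult : LogVertex (isArc v)}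
    (εincl : LogEdge (isArc v) νmult (LogVertex.spaceLink (isArc v)))
    (εid : LogEdge (isArc v) (LogVertex.postLog (isArc v)) νpre)
    (R : L.Nplus v ⥤ TBPlus.{w}) (x : L.X)
    (hmult : (R.obj ((L.lam v νmult).obj ((frobeniusTwist L.log νmult.isPostLog).obj
      ((frobeniusTwist L.log (LogVertex.postLog (isArc v)).isPostLog).obj x)))).IsCircle)
    (hpre : (R.obj ((L.lam v νpre).obj x)).IsPlane) : False := by
  have a := (L.iota v εincl).app ((frobeniusTwist L.log (LogVertex.postLog (isArc v)).isPostLog).obj x)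
  have c : (L.lam v (LogVertex.spaceLink (isArc v))).obj
        ((frobeniusTwist L.log (LogVertex.postLog (isArc v)).isPostLog).obj x) ⟶
      (L.lam v (LogVertex.postLog (isArc v))).obj
        ((frobeniusTwist L.log (LogVertex.postLog (isArc v)).isPostLog).obj x) :=
    eqToHom (Functor.congr_obj (L.lam_spaceLink_eq_postLog v) _)
  have b := (L.iota v εid).app x
  exact (TBPlus.isEmpty_hom_of_isCircle_of_isPlane hmult hpre).false (R.map (a ≫ c ≫ b))

/-- ★ The same over an ALL-ARCHIMEDEAN index (`isArc ≡ true`; the edges are literally `k^× ↪ k` and `k~ →(id) k~`, the twists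
compute: `Λ_{mult} = id`, `Λ_{post-log} = log`): no `R : 𝒩⊞_v ⥤ TB⊞` has `R(λ⊞_{v,mult}(log x))` circle-type and `R(λ⊞_{v,pre}(x))`
plane-type. [cite: MochizukiAbsTopIII2015, Def 5.4 (v) p. 127] -/
theorem false_of_tbplus_shapes_arc {Vmod : Type u} (L : LogFrobeniusSetting Vmod (fun _ => true)) (v : Vmod)
    (R : L.Nplus v ⥤ TBPlus.{w}) (x : L.X)
    (hmult : (R.obj ((L.lam v ArchVertex.mult).obj (L.log.obj x))).IsCircle)
    (hpre : (R.obj ((L.lam v ArchVertex.pre).obj x)).IsPlane) : False :=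
  L.false_of_tbplus_shapes v (νpre := ArchVertex.pre) (νmult := ArchVertex.mult)
    (show ArchEdge ArchVertex.mult ArchVertex.spaceLink from ArchEdge.multToSpaceLink)
    (show ArchEdge ArchVertex.postLog ArchVertex.pre from ArchEdge.postLogId) R x hmult hpre

/-! ## §4. Consequence for the `η⊢` add-on: empty at every print-shaped `ψ`-side -/

/-- the pre-log vertex `k~` of `Γ⃗^×_arc` is a cross vertex. [cite: MochizukiAbsTopIII2015, Def 5.4 (v) p. 127] -/
theorem isCross_arcPre : LogVertex.IsCross (b := true) ArchVertex.pre := ⟨rfl, rfl⟩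

/-- the multiplicative vertex `k^×` of `Γ⃗^×_arc` is a cross vertex. [cite: MochizukiAbsTopIII2015, Def 5.4 (v) p. 127] -/
theorem isCross_arcMult : LogVertex.IsCross (b := true) ArchVertex.mult := ⟨rfl, rfl⟩

namespace MonoTelecoreCoherence

/-- ★★ **`MonoTelecoreCoherence` is EMPTY at every carrier whose `ψ`-side has print's archimedean shapes.**  Over an
all-archimedean index, for every setting `L`, every `M`, every `K : L.MonoTelecoreCoherence M`, every place `v` and every
`TB⊞`-reading `S : 𝒩⊢⊞_v ⥤ TB⊞` under which `ψ^{An⊢⊞}_{v,pre}` takes plane-type values (`k~(G) = C~ × C~`) and `ψ^{An⊢⊞}_{v,mult}`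
circle-type values (`k^×(G) = C^× × C~`): `False` as soon as `𝒳` has an object — transport the shapes along
`η⊢_{v,pre}`, `η⊢_{v,mult}` (`K.eta`, isomorphisms in `𝒩⊢⊞_v`) to `R := (𝒩⊞_v → 𝒩⊢⊞_v) ⋙ S` and apply `false_of_tbplus_shapes_arc`.
Whatever `𝒩⊞_v`, `λ⊞_{v,ν}`, `𝒩⊞_v → 𝒩⊢⊞_v` are. [cite: MochizukiAbsTopIII2015, Cor 5.10 (iv)(c) p. 148] -/
theorem false_of_arc_psi_shapes {Vmod : Type u} {L : LogFrobeniusSetting Vmod (fun _ => true)}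
    {M : L.MonoAnalyticizationHomotopies} (K : L.MonoTelecoreCoherence M) (v : Vmod)
    (S : L.NmonoPlus v ⥤ TBPlus.{w})
    (hpre : ∀ a : L.AnMono, (S.obj ((L.ψAnMono v ⟨ArchVertex.pre, isCross_arcPre⟩).obj a)).IsPlane)
    (hmult : ∀ a : L.AnMono, (S.obj ((L.ψAnMono v ⟨ArchVertex.mult, isCross_arcMult⟩).obj a)).IsCircle)
    (x : L.X) : False := by
  refine false_of_tbplus_shapes_arc L v (L.monoNplus v ⋙ S) x ?_ ?_
  · exact TBPlus.IsCircle.of_iso (hmult _) (S.mapIso ((K.eta v ArchVertex.mult isCross_arcMult).app (L.log.obj x)))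
  · exact TBPlus.IsPlane.of_iso (hpre _) (S.mapIso ((K.eta v ArchVertex.pre isCross_arcPre).app x))

end MonoTelecoreCoherence

/-! ## §5. Instance: abc-iut-w6-d025's arc chart -/

variable (𝔄 : AutHolFieldFunctor.{u}) (Vmod' : Type (u + 1))

/-- At the arc chart, `ψ^{An⊢⊞}_{v,pre}` reads `k~(G)` — plane-type — in the `TB⊞`-factor of `𝒩⊢⊞_v = TM⊢ × TB⊞`.
[cite: MochizukiAbsTopIII2015, Prop 5.8 (vii) p. 141] -/
theorem archGenuineMonoAnChart_ψ_pre_isPlane (v : Vmod') (a : (archGenuineMonoAnChart 𝔄 Vmod' (fun _ => true)).AnMono) :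
    ((CategoryTheory.Prod.snd TMMono.{u + 1} TBPlus.{u + 1}).obj
      (((archGenuineMonoAnChart 𝔄 Vmod' (fun _ => true)).ψAnMono v ⟨ArchVertex.pre, isCross_arcPre⟩).obj a)).IsPlane :=
  TMMono.kTildeObj_isPlane

/-- At the arc chart, `ψ^{An⊢⊞}_{v,mult}` reads `k^×(G)` — circle-type. [cite: MochizukiAbsTopIII2015, Prop 5.8 (vii) p. 141] -/
theorem archGenuineMonoAnChart_ψ_mult_isCircle (v : Vmod') (a : (archGenuineMonoAnChart 𝔄 Vmod' (fun _ => true)).AnMono) :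
    ((CategoryTheory.Prod.snd TMMono.{u + 1} TBPlus.{u + 1}).obj
      (((archGenuineMonoAnChart 𝔄 Vmod' (fun _ => true)).ψAnMono v ⟨ArchVertex.mult, isCross_arcMult⟩).obj a)).IsCircle :=
  TMMono.kTimesObj_isCircle

/-- ★★★ **The `η⊢` add-on `MonoTelecoreCoherence` is EMPTY at abc-iut-w6-d025's arc chart**, for every choice of the
mono-analyticization homotopies `M`, over every nonempty all-archimedean index and as soon as `𝒞^hol_TF` has an object (the arc
analogue of abc-iut-f-101's `LogFrobeniusMonoTelecoreCoherenceEmptyAtMonoAn`): its `ψ` is the genuine `ψArc` (`k~(G)` at `pre`,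
`k^×(G)` at `mult`), so `false_of_arc_psi_shapes` applies with `S := pr₂`. [cite: MochizukiAbsTopIII2015, Cor 5.10 (iv)(c) p. 148] -/
theorem isEmpty_monoTelecoreCoherence_archGenuineMonoAnChart [Nonempty Vmod'] [Nonempty (HolTFPair 𝔄)]
    (M : (archGenuineMonoAnChart 𝔄 Vmod' (fun _ => true)).MonoAnalyticizationHomotopies) :
    IsEmpty ((archGenuineMonoAnChart 𝔄 Vmod' (fun _ => true)).MonoTelecoreCoherence M) :=
  ⟨fun K => MonoTelecoreCoherence.false_of_arc_psi_shapes K (Classical.arbitrary Vmod')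
    (CategoryTheory.Prod.snd TMMono.{u + 1} TBPlus.{u + 1})
    (archGenuineMonoAnChart_ψ_pre_isPlane 𝔄 Vmod' _) (archGenuineMonoAnChart_ψ_mult_isCircle 𝔄 Vmod' _)
    (ULift.up (Classical.arbitrary (HolTFPair 𝔄)))⟩

/-- Hence, at the arc chart, NO `(M, K)` exists at all: the typed `η⊢`-datum of Cor 5.10 (iv)(c) cannot be supplied there
(nor, by `false_of_arc_psi_shapes`, at any carrier sharing its `ψ`-side). [cite: MochizukiAbsTopIII2015, Cor 5.10 (iv)(c) p. 148] -/
theorem not_exists_monoTelecoreCoherence_archGenuineMonoAnChart [Nonempty Vmod'] [Nonempty (HolTFPair 𝔄)] :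
    ¬ ∃ (M : (archGenuineMonoAnChart 𝔄 Vmod' (fun _ => true)).MonoAnalyticizationHomotopies),
      Nonempty ((archGenuineMonoAnChart 𝔄 Vmod' (fun _ => true)).MonoTelecoreCoherence M) :=
  fun ⟨M, ⟨K⟩⟩ => (isEmpty_monoTelecoreCoherence_archGenuineMonoAnChart 𝔄 Vmod' M).false K

end LogFrobeniusSetting

end Literature.AnabelianGeometry.AbsoluteAnabelian
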